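import Literature.NumberTheory.EllipticCurves.DeShalit1987.KatzPAdicLFunction
import Literature.NumberTheory.GaloisRepresentations.HeckeLFunctionValueOfNegativeWeight
import HarnessLib

/-!
# `L_𝔣(ε, 0) = ∏_{w ∣ 𝔣}(1 − ε(w)) · L(ε, 0)` at the absolutely convergent weights, in the currency of
# `DeShalit1987.interpolationValue` (de Shalit 1987, II.4.12 (32) / II.4.16 (50))

Topic `Literature/NumberTheory/EllipticCurves` (grouping sub-namespace `DeShalit1987`); theorems only, no
definition, no named fact. Adapter between the IMPRIMITIVE ideal Dirichlet series at `s = 0` delivered by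
the Eisenstein-number files (`EisensteinNumbersPartialHeckeL`, `EisensteinKroneckerNumbersClassSum`:
`rayClassLSeries 𝔪 (…) 0` for the lane's modulus `𝔪 = 𝔤^{M+1}v̄^{M+1}`, whose support `S ∪ {v̄}` may exceed
the ramified places of `ε`) and the binders of `DeShalit1987.interpolationValue p v v̄ S ε m j Ω δ Lval`
(§1 of `KatzPAdicLFunction.lean`): `removedEulerFactorsAtZero ε (insert v̄ S) = ∏_{w ∈ S ∪ {v̄}} (1 − ε(w))`
(`heckeValueExtZero`: `ε(w)` extended by zero at ramified `w`) and `Lval = hL.continuation 0` ((T4)).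

de Shalit II.4.12 (32): "`∫ ε dμ = (1 − ε(𝔭)/p)·∏_{𝔩∣𝔣}(1 − ε(𝔩))·L_∞(ε⁻¹ … )`", II.4.16 (50); here as the
elementary change of modulus for a character of exponent `σ > 1` (Neukirch VII §8, before (8.5)),
on `GaloisRepresentations/HeckeLFunctionValueOfNegativeWeight.lean` §5.

* `DeShalit1987.rayClassCoeff_congr_modulus` — `rayClassCoeff 𝔪 ψ = rayClassCoeff 𝔪' ψ` when `𝔪, 𝔪' ≠ 0`
  have the same prime support;
* ★★ `DeShalit1987.rayClassLSeries_zero_eq_removedEulerFactorsAtZero_mul_continuation_zero` — for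
  `χ : HeckeCharacter K` of exponent `σ > 1` (`∀ x, ‖χ x‖ = ‖x‖^σ`), a modulus `𝔪 ≠ 0` whose prime support
  is a finite set `T` containing every ramified place of `χ`, and `hL : HasEntireContinuation (heckeLFunction χ)`:
  **`rayClassLSeries 𝔪 (χ(ϖ_·)) 0 = removedEulerFactorsAtZero χ T · hL.continuation 0`.**

References: E. de Shalit (1987), II.4.12 (32) (p. 67), II.4.16 (50) (p. 77) [deShalit1987]; J. Neukirch,
*Algebraic Number Theory* (1999), Ch. VII §8 (before (8.5)) [NeukirchANT1999].

Mathlib / tree search: tree `HeckeCharacter.rayClassLSeries_mul_zero_eq_prod_mul_continuation_zero`,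
`removedEulerFactorsAtZero`, `heckeValueExtZero_of_isUnramifiedAt/_of_not_isUnramifiedAt`,
`LFunctions.isCoprime_iff_forall_not_le`; Mathlib `Ideal.IsPrime.prod_le`, `Ideal.IsPrime.mul_le`,
`Finset.prod_filter_mul_prod_filter_not` (`lean search 'removedEulerFactorsAtZero.*continuation'` — nothing).
-/

noncomputable section

open NumberField IsDedekindDomain
open Literature.NumberTheory.LFunctions Literature.NumberTheory.GaloisRepresentations

namespace Literature.NumberTheory.EllipticCurves.DeShalit1987

variable {K : Type} [Field K] [NumberField K]

/-- The `L`-series coefficients only depend on the prime SUPPORT of the modulus: if `𝔪, 𝔪' ≠ 0` lie under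
the same primes then `rayClassCoeff 𝔪 ψ = rayClassCoeff 𝔪' ψ`. [cite: NeukirchANT1999, Ch. VII §8 (before (8.5))] -/
theorem rayClassCoeff_congr_modulus {𝔪 𝔪' : Ideal (𝓞 K)} (h𝔪 : 𝔪 ≠ ⊥) (h𝔪' : 𝔪' ≠ ⊥)
    (h : ∀ v : HeightOneSpectrum (𝓞 K), 𝔪 ≤ v.asIdeal ↔ 𝔪' ≤ v.asIdeal)
    (ψ : HeightOneSpectrum (𝓞 K) → ℂ) (I : Ideal (𝓞 K)) :
    rayClassCoeff 𝔪 ψ I = rayClassCoeff 𝔪' ψ I := by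
  classical
  have hiff : (I ≠ ⊥ ∧ IsCoprime I 𝔪) ↔ (I ≠ ⊥ ∧ IsCoprime I 𝔪') := by
    refine and_congr_right fun _ ↦ ?_
    rw [isCoprime_iff_forall_not_le h𝔪, isCoprime_iff_forall_not_le h𝔪']
    exact forall_congr' fun v ↦ by rw [h v]
  unfold rayClassCoeff
  by_cases hI : I ≠ ⊥ ∧ IsCoprime I 𝔪
  · rw [if_pos hI, if_pos (hiff.mp hI)]
  · rw [if_neg hI, if_neg (fun h' ↦ hI (hiff.mpr h'))]

/-- A product of distinct height-one primes lies under the prime `v` iff `v` is one of them.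
[cite: NeukirchANT1999, Ch. I §3 (unique factorisation)] -/
private theorem prod_asIdeal_le_iff (R : Finset (HeightOneSpectrum (𝓞 K))) (v : HeightOneSpectrum (𝓞 K)) :
    ∏ w ∈ R, w.asIdeal ≤ v.asIdeal ↔ v ∈ R := by
  rw [Ideal.IsPrime.prod_le v.isPrime]
  constructor
  · rintro ⟨w, hw, hle⟩
    have : w = v := HeightOneSpectrum.ext (w.isMaximal.eq_of_le v.isPrime.ne_top hle)
    exact this ▸ hw
  · exact fun hv ↦ ⟨v, hv, le_rfl⟩

omit [NumberField K] in
/-- A product of height-one primes is a nonzero ideal. [cite: NeukirchANT1999, Ch. I §3] -/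
private theorem prod_asIdeal_ne_bot (R : Finset (HeightOneSpectrum (𝓞 K))) :
    ∏ w ∈ R, w.asIdeal ≠ (⊥ : Ideal (𝓞 K)) :=
  Finset.prod_ne_zero_iff.mpr fun w _ ↦ w.ne_bot

/-- ★★ **`L_𝔪(χ, 0) = ∏_{w ∈ T, χ unramified at w}(1 − χ(ϖ_w)) · L(χ, 0) = removedEulerFactorsAtZero χ T · hL.continuation 0`**
for a Hecke character of exponent `σ > 1` (negative weight `≤ −3`), a modulus `𝔪 ≠ 0` with prime support the
finite set `T ⊇ {ramified places of χ}`, and any entire continuation `hL` of `heckeLFunction χ` — the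
(T4)/`removedEulerFactorsAtZero` binders of `interpolationValue` evaluated against the imprimitive convergent
series of the Eisenstein-number identities (II.3.5 (13) summed over classes). Proof: split `T` into ramified
`R` and unramified `U`, `𝔪₁ = ∏_R 𝔭`, `𝔪₂ = ∏_U 𝔭` (same support as `𝔪`), and apply
`rayClassLSeries_mul_zero_eq_prod_mul_continuation_zero`. [cite: deShalit1987, II.4.12 (32) (p. 67) and II.4.16 (50) (p. 77)] [cite: NeukirchANT1999, Ch. VII §8 (before (8.5))] -/
theorem rayClassLSeries_zero_eq_removedEulerFactorsAtZero_mul_continuation_zero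
    {χ : HeckeCharacter K} {σ : ℝ}
    (hσ : ∀ x : ideleGroup K, ‖((χ x : ℂˣ) : ℂ)‖ = ideleNorm x ^ σ) (h1 : 1 < σ)
    {𝔪 : Ideal (𝓞 K)} (h𝔪 : 𝔪 ≠ ⊥) {T : Finset (HeightOneSpectrum (𝓞 K))}
    (hT : ∀ v : HeightOneSpectrum (𝓞 K), 𝔪 ≤ v.asIdeal ↔ v ∈ T)
    (hram : ∀ v : HeightOneSpectrum (𝓞 K), ¬ χ.IsUnramifiedAt v → v ∈ T)
    (hL : LFunction.HasEntireContinuation (heckeLFunction χ)) :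
    rayClassLSeries 𝔪 (fun v ↦ χ.valueAtUniformizer v) 0 =
      removedEulerFactorsAtZero χ T * hL.continuation 0 := by
  classical
  set R : Finset (HeightOneSpectrum (𝓞 K)) := T.filter fun v ↦ ¬ χ.IsUnramifiedAt v with hR
  set U : Finset (HeightOneSpectrum (𝓞 K)) := T.filter fun v ↦ χ.IsUnramifiedAt v with hU
  set 𝔪₁ : Ideal (𝓞 K) := ∏ w ∈ R, w.asIdeal with h𝔪₁def
  set 𝔪₂ : Ideal (𝓞 K) := ∏ w ∈ U, w.asIdeal with h𝔪₂def
  have h𝔪₁ : 𝔪₁ ≠ ⊥ := prod_asIdeal_ne_bot R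
  have h𝔪₂ : 𝔪₂ ≠ ⊥ := prod_asIdeal_ne_bot U
  have hle₁ : ∀ v : HeightOneSpectrum (𝓞 K), 𝔪₁ ≤ v.asIdeal ↔ v ∈ R := prod_asIdeal_le_iff R
  have hle₂ : ∀ v : HeightOneSpectrum (𝓞 K), 𝔪₂ ≤ v.asIdeal ↔ v ∈ U := prod_asIdeal_le_iff U
  have hmemR : ∀ v, v ∈ R ↔ v ∈ T ∧ ¬ χ.IsUnramifiedAt v := fun v ↦ by rw [hR, Finset.mem_filter]
  have hmemU : ∀ v, v ∈ U ↔ v ∈ T ∧ χ.IsUnramifiedAt v := fun v ↦ by rw [hU, Finset.mem_filter]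
  -- `𝔪₁` cuts out exactly the ramified places
  have hiff : ∀ v : HeightOneSpectrum (𝓞 K), χ.IsUnramifiedAt v ↔ ¬ 𝔪₁ ≤ v.asIdeal := by
    intro v
    rw [hle₁, hmemR]
    constructor
    · exact fun h ⟨_, h'⟩ ↦ h' h
    · intro h
      by_contra hv
      exact h ⟨hram v hv, hv⟩
  -- the primes of `𝔪₂` not dividing `𝔪₁` are exactly `U`
  have hS : ∀ v : HeightOneSpectrum (𝓞 K), v ∈ U ↔ 𝔪₂ ≤ v.asIdeal ∧ ¬ 𝔪₁ ≤ v.asIdeal := by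
    intro v
    rw [hle₁, hle₂, hmemR, hmemU]
    constructor
    · exact fun ⟨hT', hu⟩ ↦ ⟨⟨hT', hu⟩, fun ⟨_, hn⟩ ↦ hn hu⟩
    · exact fun ⟨h, _⟩ ↦ h
  -- `𝔪` and `𝔪₁𝔪₂` have the same support `T`
  have hsupp : ∀ v : HeightOneSpectrum (𝓞 K), 𝔪 ≤ v.asIdeal ↔ 𝔪₁ * 𝔪₂ ≤ v.asIdeal := by
    intro v
    rw [Ideal.IsPrime.mul_le v.isPrime, hle₁, hle₂, hT, hmemR, hmemU]
    constructor
    · intro hv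
      by_cases hu : χ.IsUnramifiedAt v
      · exact Or.inr ⟨hv, hu⟩
      · exact Or.inl ⟨hv, hu⟩
    · rintro (⟨hv, _⟩ | ⟨hv, _⟩) <;> exact hv
  have hser : rayClassLSeries 𝔪 (fun v ↦ χ.valueAtUniformizer v) 0 =
      rayClassLSeries (𝔪₁ * 𝔪₂) (fun v ↦ χ.valueAtUniformizer v) 0 := by
    unfold rayClassLSeries
    exact tsum_congr fun I ↦ by
      rw [rayClassCoeff_congr_modulus h𝔪 (mul_ne_zero h𝔪₁ h𝔪₂) hsupp]
  rw [hser, HeckeCharacter.rayClassLSeries_mul_zero_eq_prod_mul_continuation_zero hσ h1 h𝔪₁ h𝔪₂ hiff hS hL]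
  congr 1
  -- `∏_{v ∈ U}(1 − χ(ϖ_v)) = ∏_{v ∈ T}(1 − heckeValueExtZero χ v)`
  rw [removedEulerFactorsAtZero, ← Finset.prod_filter_mul_prod_filter_not T (fun v ↦ χ.IsUnramifiedAt v)]
  have hRone : ∏ v ∈ T.filter (fun v ↦ ¬ χ.IsUnramifiedAt v), (1 - heckeValueExtZero χ v) = 1 :=
    Finset.prod_eq_one fun v hv ↦ by
      rw [heckeValueExtZero_of_not_isUnramifiedAt (Finset.mem_filter.mp hv).2, sub_zero]
  rw [hRone, mul_one, ← hU]
  exact Finset.prod_congr rfl fun v hv ↦ by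
    rw [heckeValueExtZero_of_isUnramifiedAt ((hmemU v).mp hv).2]

end Literature.NumberTheory.EllipticCurves.DeShalit1987

end
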